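import Literature.AlgebraicGeometry.Motives.JacobianThetaDivisorUniq
import Literature.AlgebraicGeometry.Motives.AbelianVarietyTorsionProofs
import Literature.AlgebraicGeometry.Dimension.FibreLocalRingDimension
import Literature.AlgebraicGeometry.Resolution.FibreComponentsBaseChange
import HarnessLib

/-!
# The Brill–Noether locus `W̃_{g−1}(P)` of a Jacobian carrying a Riemann theta divisor has dimension `g − 1`;
# the support of an effective Cartier divisor with irreducible support has dimension `dim X − 1`
# (Hartshorne II.6: prime divisors have codimension one; Görtz–Wedhorn I, Thm. 5.22; Lange 2023, Lemma 4.2.1 (ii) for `n = g − 1`)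

Layer `Literature/AlgebraicGeometry/Motives`, namespaces `Literature.AlgebraicGeometry.Motives.CartierDivisor` / `….AbelianVariety` / `….Jacobian`.
KERNEL ONLY: theorems; no definition, no named fact, no instance, no `sorry`.

On a regular integral Noetherian scheme `X` the support `Z = X ∖ X_1` of an effective Cartier divisor `D` (the complement of the
non-vanishing locus of its canonical section, ★ `CartierDivisor.nonvanishing`) whose support is IRREDUCIBLE is a prime divisor: its
generic point `η` has codimension one (★ `IsEffective.exists_sameDivisor_smul_of_support_eq_closure`, `Motives/CartierDivisorMultiplicityOfIrreducibleSupport`,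
Hartshorne II.6.11: `D = a·[Z]`, `coheight η = 1`).  If `X` is moreover locally of finite type over a field `K`, the dimension formula
`dim 𝒪_{X,η} + dim closure {η} = dim X` (★ `Dimension.coheight_add_height_eq_topologicalKrullDim`, Görtz–Wedhorn I Thm. 5.22 (3)) and
`dim closure {η} = height η` (★ `Resolution.topologicalKrullDim_closure_singleton_eq_height`) give

* **`CartierDivisor.IsEffective.topologicalKrullDim_support_add_one`** — `dim Z + 1 = dim X` (Krull dimensions of the underlying spaces);
* **`AbelianVariety.topologicalKrullDim_support_add_one`** / **`…_support_eq`** — on an abelian variety `A` over a field: `dim Z + 1 = dim A`,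
  `dim Z = dim A − 1` (`A` is regular ★ `isRegularLocalRing_stalk`, Noetherian ★ `isNoetherian_left`, `dim A = topKrullDim` ★ `topologicalKrullDim_left`);
* `AbelianVariety.topologicalKrullDim_image_translation` — translates `t_x(Z)` have the same dimension (a translation is a homeomorphism);
* **`Jacobian.topologicalKrullDim_brillNoetherLocus_of_isRiemannThetaDivisor`** — for a Jacobian `𝒥` of a smooth projective geometrically
  irreducible curve `C` carrying a Riemann theta divisor `Θ` (★ `Jacobian.IsRiemannThetaDivisor`: effective with support a translate
  `t_x(W̃_{g−1}(P′))`, `g = dim J`), EVERY Brill–Noether locus `W̃_{g−1}(P) = \overline{α_{(g−1)P}(C^{g−1})}` (★ `Jacobian.brillNoetherLocus`) has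
  Krull dimension `g − 1` ([Lange2023AbelianVarietiesComplex] §4.2.1 Lemma 4.2.1 (ii) «`W_n` is of dimension `n`» at `n = g − 1`, in the presence
  of a theta divisor; all `W̃_{g−1}(P)` are translates of each other ★ `brillNoetherLocus_eq_image_translation`, and the support is irreducible ★
  `IsRiemannThetaDivisor.isIrreducible_support`).

* `Jacobian.exists_isClosedImmersion_range_eq_brillNoetherLocus` — `W̃_r(P)` carries an integral closed subscheme structure (reduced induced
  structure, Mathlib `Scheme.IdealSheafData.vanishingIdeal`; ★ `Resolution.isIntegral_subscheme_vanishingIdeal`), and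
  `Jacobian.topologicalKrullDim_eq_of_range_eq_brillNoetherLocus` — `dim W = g − 1` for any closed immersion `W ↪ J` onto `W̃_{g−1}(P)`
  (the hypotheses-form in which the cell's road (E) states its leaves).

Use (cell `hodgecm-mathlib`, D-0151; crux HLiu418 = stmt-HodgeConjecture-24832, road G4 leaf (P0) «`dim W̃_{g−1} = g − 1`» of the (3a) Step-I programme,
`CENSUS-P0-BrillNoetherDimension`).  COUNT-NEUTRAL capital; HC_CM is proved only modulo the 7 printed citations until rung 0 closes.

## References
* [Hartshorne1977] R. Hartshorne, *Algebraic Geometry* (1977), II.6 (prime divisors: closed integral subschemes of codimension one, p. 130;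
  Prop. 6.11 and Remark 6.11.2, pp. 141–142) and II Ex. 3.20 (d) (`dim Y + codim(Y, X) = dim X` for integral schemes of finite type over a field).
* [GortzWedhorn2020] U. Görtz, T. Wedhorn, *Algebraic Geometry I*, 2nd ed. (2020), Thm. 5.22 (3) and Prop. 5.30 (dimension and codimension for
  schemes of finite type over a field), Thm. 11.40 (2).
* [Lange2023AbelianVarietiesComplex] H. Lange, *Abelian Varieties over the Complex Numbers* (2023), §4.2.1 Lemma 4.2.1 (ii) (`W̃_n` irreducible
  closed of dimension `n` for `n ≤ g`) and Cor. 4.2.4 (`W̃_{g−1}` is a theta divisor).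
* [MumfordAV1970] D. Mumford, *Abelian Varieties* (1970), §4 (translations).
-/

noncomputable section

universe u

open CategoryTheory AlgebraicGeometry Order Topology
open Literature.AlgebraicGeometry.Dimension Literature.AlgebraicGeometry.Resolution TopologicalSpace

namespace Literature.AlgebraicGeometry.Motives

namespace CartierDivisor

variable {K : Type u} [Field K] {X : Scheme.{u}} [IsIntegral X] [IsNoetherian X]

/-- **The support of an effective Cartier divisor with irreducible support has dimension `dim X − 1`**: for `X` regular, integral,
Noetherian and locally of finite type over a field `K`, and `D` effective with `Z = X ∖ X_1` irreducible,
`topologicalKrullDim Z + 1 = topologicalKrullDim X` — the generic point `η` of `Z` has `coheight η = 1` (Hartshorne II.6.11: `D = a·[Z]` with `[Z]` a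
prime divisor) and `coheight η + height η = dim X`, `height η = dim closure {η}` (Görtz–Wedhorn I, Thm. 5.22 (3)).
[cite: Hartshorne1977, II.6 Prop. 6.11 and Remark 6.11.2 (pp. 141–142); II Ex. 3.20 (d)] [cite: GortzWedhorn2020, Thm. 5.22 (3) and Prop. 5.30] -/
theorem IsEffective.topologicalKrullDim_support_add_one (f : X ⟶ Spec (.of K)) [LocallyOfFiniteType f]
    (hX : Scheme.IsRegular X) {D : CartierDivisor X} (hD : D.IsEffective) (hirr : IsIrreducible (D.nonvanishing 1)ᶜ) :
    topologicalKrullDim ↥((D.nonvanishing 1)ᶜ) + 1 = topologicalKrullDim X := by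
  have hcl : IsClosed (D.nonvanishing 1)ᶜ := (D.isOpen_nonvanishing 1).isClosed_compl
  have hgen : IsGenericPoint hirr.genericPoint (D.nonvanishing 1)ᶜ := hirr.closure_genericPoint hcl
  obtain ⟨h1, -⟩ := hD.exists_sameDivisor_smul_of_support_eq_closure hX hgen.symm
  have hsum := coheight_add_height_eq_topologicalKrullDim f hirr.genericPoint
  rw [topologicalKrullDim_eq_height_of_isGenericPoint hgen, ← hsum, h1]
  push_cast
  rw [add_comm]

end CartierDivisor

namespace AbelianVariety

variable {k : Type u} [Field k] (A : AbelianVariety k)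

/-- **On an abelian variety, the support of an effective Cartier divisor with irreducible support has dimension `dim A − 1`**
(`topologicalKrullDim Z + 1 = dim A`): abelian varieties are regular, integral, Noetherian and of finite type over `k`.
[cite: Hartshorne1977, II.6 Prop. 6.11 and Remark 6.11.2 (pp. 141–142); II Ex. 3.20 (d)] [cite: GortzWedhorn2020, Thm. 5.22 (3)] -/
theorem topologicalKrullDim_support_add_one {D : CartierDivisor A.X.left} (hD : D.IsEffective)
    (hirr : IsIrreducible (D.nonvanishing 1)ᶜ) :
    topologicalKrullDim ↥((D.nonvanishing 1)ᶜ) + 1 = (A.dim : WithBot ℕ∞) := by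
  haveI := A.isNoetherian_left
  rw [← A.topologicalKrullDim_left]
  exact hD.topologicalKrullDim_support_add_one A.X.hom (fun x => A.isRegularLocalRing_stalk x) hirr

/-- The same as `topologicalKrullDim Z = dim A − 1` (an abelian variety carrying an effective divisor with non-empty irreducible support
has `dim A ≥ 1`). [cite: Hartshorne1977, II.6 (p. 130: prime divisors have codimension one); II Ex. 3.20 (d)] -/
theorem topologicalKrullDim_support_eq {D : CartierDivisor A.X.left} (hD : D.IsEffective)
    (hirr : IsIrreducible (D.nonvanishing 1)ᶜ) :
    topologicalKrullDim ↥((D.nonvanishing 1)ᶜ) = ((A.dim - 1 : ℕ) : WithBot ℕ∞) := by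
  have h := A.topologicalKrullDim_support_add_one hD hirr
  generalize topologicalKrullDim ↥((D.nonvanishing 1)ᶜ) = z at h ⊢
  induction z using WithBot.recBotCoe with
  | bot => simp at h
  | coe d =>
    have h' : d + 1 = (A.dim : ℕ∞) := by exact_mod_cast h
    induction d using ENat.recTopCoe with
    | top => simp at h'
    | coe n =>
      have hn : n + 1 = A.dim := by exact_mod_cast h'
      have : n = A.dim - 1 := by omega
      subst this
      rfl

/-- Translates of a subset of an abelian variety have the same Krull dimension (the translation `t_x` is an automorphism of the
underlying scheme, hence a homeomorphism onto its image). [cite: MumfordAV1970, §4 (translations t_x are automorphisms)] -/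
theorem topologicalKrullDim_image_translation (x : A.Points k) (Z : Set A.X.left) :
    topologicalKrullDim ↥((A.translation x).left.base '' Z) = topologicalKrullDim ↥Z := by
  have e : ↥Z ≃ₜ ↥((A.translation x).left.base '' Z) :=
    ((A.translationIso x).hom.left.homeomorph.image Z).trans (Homeomorph.setCongr rfl)
  exact (IsHomeomorph.topologicalKrullDim_eq e e.isHomeomorph).symm

end AbelianVariety

namespace Jacobian

variable {k : Type u} [Field k] {C : SchemeOver k}

/-- **`dim W̃_{g−1}(P) = g − 1` for a Jacobian carrying a Riemann theta divisor** (`g = dim J`): the support `t_x(W̃_{g−1}(P′))` of `Θ` is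
the irreducible support of an effective Cartier divisor on the abelian variety `J`, hence of dimension `dim J − 1`
(`AbelianVariety.topologicalKrullDim_support_eq`); translations are homeomorphisms and every `W̃_{g−1}(P)` is a translate of `W̃_{g−1}(P′)`
(★ `brillNoetherLocus_eq_image_translation`).  [Lange2023] Lemma 4.2.1 (ii) at `n = g − 1` / Cor. 4.2.4, in the presence of a theta divisor.
[cite: Lange2023AbelianVarietiesComplex, §4.2.1 Lemma 4.2.1 (ii) and Cor. 4.2.4] [cite: Hartshorne1977, II.6 Prop. 6.11 and Remark 6.11.2 (pp. 141–142)] -/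
theorem topologicalKrullDim_brillNoetherLocus_of_isRiemannThetaDivisor {n : ℕ} (hC : IsSmoothProjective n C) (𝒥 : Jacobian C)
    {Θ : CartierDivisor 𝒥.J.X.left} (h : 𝒥.IsRiemannThetaDivisor Θ) (P : AlgPoints C k) :
    topologicalKrullDim ↥(𝒥.brillNoetherLocus P (𝒥.J.dim - 1)) = ((𝒥.J.dim - 1 : ℕ) : WithBot ℕ∞) := by
  obtain ⟨P', x, hsupp⟩ := h.exists_support_eq
  have hdim := 𝒥.J.topologicalKrullDim_support_eq h.isEffective (h.isIrreducible_support hC)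
  rw [hsupp, 𝒥.J.topologicalKrullDim_image_translation] at hdim
  rw [𝒥.brillNoetherLocus_eq_image_translation P' P, 𝒥.J.topologicalKrullDim_image_translation]
  exact hdim

/-- The same in the form `dim W̃_{g−1}(P) + 1 = dim J`. [cite: Lange2023AbelianVarietiesComplex, §4.2.1 Lemma 4.2.1 (ii) and Cor. 4.2.4] -/
theorem topologicalKrullDim_brillNoetherLocus_add_one_of_isRiemannThetaDivisor {n : ℕ} (hC : IsSmoothProjective n C) (𝒥 : Jacobian C)
    {Θ : CartierDivisor 𝒥.J.X.left} (h : 𝒥.IsRiemannThetaDivisor Θ) (P : AlgPoints C k) :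
    topologicalKrullDim ↥(𝒥.brillNoetherLocus P (𝒥.J.dim - 1)) + 1 = (𝒥.J.dim : WithBot ℕ∞) := by
  obtain ⟨P', x, hsupp⟩ := h.exists_support_eq
  have hdim := 𝒥.J.topologicalKrullDim_support_add_one h.isEffective (h.isIrreducible_support hC)
  rw [hsupp, 𝒥.J.topologicalKrullDim_image_translation] at hdim
  rw [𝒥.brillNoetherLocus_eq_image_translation P' P, 𝒥.J.topologicalKrullDim_image_translation]
  exact hdim

/-! ## §3 The Brill–Noether locus as an integral closed subscheme (the scheme structure used by road (E)) -/

/-- **`W̃_r(P)` carries an INTEGRAL closed subscheme structure** (the reduced induced structure on the closed irreducible set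
`W̃_r(P)`, Mathlib `Scheme.IdealSheafData.vanishingIdeal`/`subscheme`; integral by ★ `Resolution.isIntegral_subscheme_vanishingIdeal` since
`W̃_r(P)` is irreducible ★ `isIrreducible_brillNoetherLocus`): there are a scheme `W` and a CLOSED IMMERSION `ι : W ⟶ J` with `W` integral
and `range ι = W̃_r(P)` — the hypotheses-form under which the (3a) leaves of the cell's road (E) are stated.
[cite: Lange2023AbelianVarietiesComplex, §4.2.1 Lemma 4.2.1 (ii)] [cite: Hartshorne1977, II Ex. 3.11 (d) and II.3 Example 3.2.6 (reduced induced closed subscheme)] -/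
theorem exists_isClosedImmersion_range_eq_brillNoetherLocus [GeometricallyIrreducible C.hom] (𝒥 : Jacobian C)
    (P : AlgPoints C k) (r : ℕ) :
    ∃ (W : Scheme.{u}) (ι : W ⟶ 𝒥.J.X.left), IsClosedImmersion ι ∧ IsIntegral W ∧
      Set.range ι.base = 𝒥.brillNoetherLocus P r := by
  open Scheme.IdealSheafData in
  let Z : TopologicalSpace.Closeds 𝒥.J.X.left := ⟨𝒥.brillNoetherLocus P r, 𝒥.isClosed_brillNoetherLocus P r⟩
  exact ⟨(vanishingIdeal Z).subscheme, (vanishingIdeal Z).subschemeι, inferInstance,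
    isIntegral_subscheme_vanishingIdeal Z (𝒥.isIrreducible_brillNoetherLocus P r), range_subschemeι_vanishingIdeal Z⟩

/-- **`dim W̃ = g − 1` in the hypotheses-form of road (E)**: for ANY closed immersion `ι : W ⟶ J` whose range is `W̃_{g−1}(P)` (e.g. the
integral one above) and a Riemann theta divisor on `J`, `topologicalKrullDim W = dim J − 1` (a closed immersion is a homeomorphism
onto its range). [cite: Lange2023AbelianVarietiesComplex, §4.2.1 Lemma 4.2.1 (ii) and Cor. 4.2.4] -/
theorem topologicalKrullDim_eq_of_range_eq_brillNoetherLocus {n : ℕ} (hC : IsSmoothProjective n C) (𝒥 : Jacobian C)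
    {Θ : CartierDivisor 𝒥.J.X.left} (h : 𝒥.IsRiemannThetaDivisor Θ) (P : AlgPoints C k)
    {W : Scheme.{u}} (ι : W ⟶ 𝒥.J.X.left) [IsClosedImmersion ι] (hrange : Set.range ι.base = 𝒥.brillNoetherLocus P (𝒥.J.dim - 1)) :
    topologicalKrullDim W = ((𝒥.J.dim - 1 : ℕ) : WithBot ℕ∞) := by
  rw [← 𝒥.topologicalKrullDim_brillNoetherLocus_of_isRiemannThetaDivisor hC h P]
  let e : (W : Type u) ≃ₜ ↥(𝒥.brillNoetherLocus P (𝒥.J.dim - 1)) :=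
    ι.isClosedEmbedding.isEmbedding.toHomeomorph.trans (Homeomorph.setCongr hrange)
  exact IsHomeomorph.topologicalKrullDim_eq e e.isHomeomorph

end Jacobian

end Literature.AlgebraicGeometry.Motives

end
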